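/-
Copyright (c) 2026 the pub-hodgecm-mathlib formalisation cell (harness21).  Prover seat hodgecm-mathlib-K2E4-p10 (g10), Track B «K2-LIT»,
#184♮ = hLiu418 = `stmt-HodgeConjecture-24832`; socket #41, KIND W — organ «Φ6b-ind» (R3)-G5: ★ (J3)'s jet continuation RE-RUN AS A FAMILY IN `h` WITH THE GROWTH CLAUSE
(KW desk F0P2-p08 (g4) 2026-09-05T01:31:06Z (B); architect K2E4-p11 (g9); (G4)'s decay lemma BY VALUE).
THEOREMS ONLY (no `def`, no `instance`, no notation, no named-fact hypothesis, no `sorry`).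
-/
import Summits.HodgeConjecture.HodgeConjecture.Theorems.K2LiuHermTwoXiJetContinuation     -- ★ p864106 (J3) (K2E4-p11): `exists_continuation_traceMoment`, ⊇ ★ (J1) (J2)
import Summits.HodgeConjecture.HodgeConjecture.Theorems.K2LiuHermTwoXiSeriesLattice       -- ★ `one_add_rpow_neg_le_two_mul`
import HarnessLib

/-!
# Crux `HLiu418`, KIND W organ «Φ6b-ind» (R3)-G5 — `K2LiuHermTwoXiJetContinuationGrowth`: the continued `h`-line jets of ξ AS A FAMILY IN `h`, WITH GROWTH
# `‖F h s‖ ≤ C·e^{−c·Σ|h_ab|}·(1 + Σ|h_ab|)^N·(1 + |det h|^{−N′})`, constants uniform in `h` (§1: the `h`-free coefficient devices of the induction step)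

Cell `hodgecm-mathlib`, crux item hLiu418 = `stmt-HodgeConjecture-24832` (helper lane `--supports … --as helper`, count-neutral), route of record `HCCMUnconditional`;
squad K2 ∕ K2Liu, road `K2_Liu`, socket #41, KIND W, block letter `hBL`, organ «Φ6b-ind» (R3) (KW desk card v4).  ★ (J3) `K2LiuHermTwoXiJetContinuation.exists_continuation_traceMoment`
continues the trace moments `M_e(h; a+s, b+s)` by induction on the ★ (J2) recursion, one `h` at a time; the (R3) growth face needs the continuation AS A FAMILY IN `h` with constants
uniform in `h`.  The step's coefficients are controlled by three `h`-free devices, typed here (§1): the determinant device `x⁻¹·(1 + x^{−N′}) ≤ 2·(1 + x^{−(N′+1)})` (`x > 0`),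
the adjugate-trace device `‖tr(adj h · Θ)‖ ≤ (Σ‖Θ‖)·(1 + Σ‖h‖)`, and the merge device for the face `e^{−cT}(1+T)^N(1+x^{−N′})` (`c ↓`, `N ↑`, `N′ ↑` at the price `2`,
★ `one_add_rpow_neg_le_two_mul`); the exponent raise `(1+T)^N·(1+T) = (1+T)^{N+1}` is ★ `K2LiuHermTwoInvMulEtaGrowth.one_add_rpow_mul_one_add` (by name in §2).  §2 (the induction with the growth conjunct, base = K2E4-p11's (G4) decay letter BY VALUE) follows in edition 2 once (G4)'s bytes are frozen.
[Shimura1982, §3 Thm. 3.1, §4 Thm. 4.2], [Shimura1997, §16.4–16.5, §18.4].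
HONEST LABEL.  Count-neutral helper; it pays no socket by itself: `HC_CM` is proved only modulo the 7 printed citations (2 remaining named inputs:
hLiu418 = `stmt-HodgeConjecture-24832`, h413 = `stmt-HodgeConjecture-24833`) until rung 0 closes.
-/

set_option autoImplicit false
set_option linter.dupNamespace false -- the mandated namespace repeats `HodgeConjecture.HodgeConjecture`

noncomputable section

open scoped Matrix ComplexConjugate
open Complex Matrix

namespace Summit.HodgeConjecture.HodgeConjecture.Cruxes.HLiu418.K2LiuHermTwoXiJetContinuationGrowth

open Summit.HodgeConjecture.HodgeConjecture.Cruxes.HLiu418.K2LiuHermTwoXiSeriesLattice (one_add_rpow_neg_le_two_mul)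

/-! ## §1 The `h`-free devices of the step -/

/-- **DETERMINANT DEVICE**: for `x > 0` and `0 ≤ N′`, `x⁻¹·(1 + x^{−N′}) ≤ 2·(1 + x^{−(N′+1)})` (the `(det h)⁻¹` of ★ (J2)'s coefficients raises the allowed blow-up exponent by one).
[folklore] -/
theorem inv_mul_one_add_rpow_neg_le {x N' : ℝ} (hx : 0 < x) (hN' : 0 ≤ N') : x⁻¹ * (1 + x ^ (-N')) ≤ 2 * (1 + x ^ (-(N' + 1))) := by
  have hx1 : x⁻¹ = x ^ (-(1 : ℝ)) := by rw [Real.rpow_neg hx.le, Real.rpow_one]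
  have hprod : x⁻¹ * x ^ (-N') = x ^ (-(N' + 1)) := by
    rw [hx1, ← Real.rpow_add hx]; congr 1; ring
  have hone : x⁻¹ ≤ 1 + x ^ (-(N' + 1)) := by
    rcases le_or_gt 1 x with h1 | h1
    · calc x⁻¹ ≤ 1 := inv_le_one_of_one_le₀ h1
        _ ≤ 1 + x ^ (-(N' + 1)) := le_add_of_nonneg_right (Real.rpow_nonneg hx.le _)
    · have h2 : x⁻¹ ≤ x ^ (-(N' + 1)) := by
        rw [hx1]
        exact Real.rpow_le_rpow_of_exponent_ge hx h1.le (by linarith)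
      linarith [h2]
  calc x⁻¹ * (1 + x ^ (-N')) = x⁻¹ + x⁻¹ * x ^ (-N') := by ring
    _ = x⁻¹ + x ^ (-(N' + 1)) := by rw [hprod]
    _ ≤ (1 + x ^ (-(N' + 1))) + x ^ (-(N' + 1)) := by linarith [hone]
    _ ≤ 2 * (1 + x ^ (-(N' + 1))) := by linarith [Real.rpow_nonneg hx.le (-(N' + 1))]

/-- **ADJUGATE-TRACE DEVICE**: `‖tr(adj h · Θ)‖ ≤ (Σ_{ij} ‖Θ i j‖)·(1 + Σ_{ij} ‖h i j‖)` for `2 × 2` matrices (the adjugate's entries are `±` entries of `h`). [folklore] -/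
theorem norm_trace_adjugate_mul_le (h Θ : Matrix (Fin 2) (Fin 2) ℂ) :
    ‖(h.adjugate * Θ).trace‖ ≤ (∑ i, ∑ j, ‖Θ i j‖) * (1 + ∑ i, ∑ j, ‖h i j‖) := by
  have hT : ∀ i j, ‖h.adjugate i j‖ ≤ ∑ i, ∑ j, ‖h i j‖ := by
    intro i j
    have hle : ∀ k l, ‖h k l‖ ≤ ∑ i, ∑ j, ‖h i j‖ := fun k l =>
      (Finset.single_le_sum (f := fun j => ‖h k j‖) (fun _ _ => norm_nonneg _) (Finset.mem_univ l)).trans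
        (Finset.single_le_sum (f := fun i => ∑ j, ‖h i j‖) (fun _ _ => Finset.sum_nonneg fun _ _ => norm_nonneg _) (Finset.mem_univ k))
    rw [Matrix.adjugate_fin_two]
    fin_cases i <;> fin_cases j
    · simpa using hle 1 1
    · simpa using hle 0 1
    · simpa using hle 1 0
    · simpa using hle 0 0
  have hΘ0 : 0 ≤ ∑ i, ∑ j, ‖Θ i j‖ := Finset.sum_nonneg fun _ _ => Finset.sum_nonneg fun _ _ => norm_nonneg _
  have hh0 : 0 ≤ ∑ i, ∑ j, ‖h i j‖ := Finset.sum_nonneg fun _ _ => Finset.sum_nonneg fun _ _ => norm_nonneg _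
  rw [Matrix.trace]
  calc ‖∑ i, (h.adjugate * Θ) i i‖ ≤ ∑ i, ‖(h.adjugate * Θ) i i‖ := norm_sum_le _ _
    _ ≤ ∑ i, ∑ j, ‖h.adjugate i j‖ * ‖Θ j i‖ := Finset.sum_le_sum fun i _ => by
        rw [Matrix.mul_apply]
        exact (norm_sum_le _ _).trans (Finset.sum_le_sum fun j _ => (norm_mul_le _ _))
    _ ≤ ∑ i, ∑ j, (∑ i, ∑ j, ‖h i j‖) * ‖Θ j i‖ := Finset.sum_le_sum fun i _ => Finset.sum_le_sum fun j _ =>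
        mul_le_mul_of_nonneg_right (hT i j) (norm_nonneg _)
    _ = (∑ i, ∑ j, ‖h i j‖) * ∑ i, ∑ j, ‖Θ j i‖ := by rw [Finset.mul_sum]; exact Finset.sum_congr rfl fun i _ => by rw [Finset.mul_sum]
    _ = (∑ i, ∑ j, ‖h i j‖) * ∑ i, ∑ j, ‖Θ i j‖ := by congr 1; exact Finset.sum_comm
    _ ≤ (∑ i, ∑ j, ‖Θ i j‖) * (1 + ∑ i, ∑ j, ‖h i j‖) := by nlinarith

/-- **MERGE DEVICE FOR THE (R3) FACE**: `e^{−cT}(1+T)^N(1 + x^{−N′}) ≤ 2·e^{−c′T}(1+T)^{N₁}(1 + x^{−N₁′})` for `c′ ≤ c`, `N ≤ N₁`, `0 ≤ N′ ≤ N₁′` (`T ≥ 0`, `x > 0`).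
[folklore] -/
theorem face_le_two_mul {c c' N N₁ N' N₁' T x : ℝ} (hT : 0 ≤ T) (hx : 0 < x) (hc : c' ≤ c) (hN : N ≤ N₁) (hN'0 : 0 ≤ N') (hN' : N' ≤ N₁') :
    Real.exp (-(c * T)) * (1 + T) ^ N * (1 + x ^ (-N')) ≤ 2 * (Real.exp (-(c' * T)) * (1 + T) ^ N₁ * (1 + x ^ (-N₁'))) := by
  have h1 : Real.exp (-(c * T)) ≤ Real.exp (-(c' * T)) := Real.exp_le_exp.2 (by nlinarith)
  have h2 : (1 + T) ^ N ≤ (1 + T) ^ N₁ := Real.rpow_le_rpow_of_exponent_le (by linarith) hN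
  have h3 : 1 + x ^ (-N') ≤ 2 * (1 + x ^ (-N₁')) := one_add_rpow_neg_le_two_mul hx hN'0 hN'
  calc Real.exp (-(c * T)) * (1 + T) ^ N * (1 + x ^ (-N'))
      ≤ Real.exp (-(c' * T)) * (1 + T) ^ N₁ * (2 * (1 + x ^ (-N₁'))) :=
        mul_le_mul (mul_le_mul h1 h2 (Real.rpow_nonneg (by linarith) N) (Real.exp_pos _).le) h3 (by positivity)
          (mul_nonneg (Real.exp_pos _).le (Real.rpow_nonneg (by linarith) N₁))
    _ = 2 * (Real.exp (-(c' * T)) * (1 + T) ^ N₁ * (1 + x ^ (-N₁'))) := by ring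

/-! ## §2 The induction with the growth conjunct ((G4)'s decay letter BY VALUE) and the head `hJet_holds_growth` (edition 2) -/

/-- **COMMON FACE OF THREE CONSTANT PACKS**: three faces `e^{−c_kT}(1+T)^{N_k}(1 + x^{−M_k})` (`c_k > 0`, `M_k ≥ 0`) are all `≤ 2·` one common face
(`c := min`, `N := max`, `M := max`). [folklore] -/
theorem exists_common_face₃ {c₁ c₂ c₃ N₁ N₂ N₃ M₁ M₂ M₃ : ℝ} (hc₁ : 0 < c₁) (hc₂ : 0 < c₂) (hc₃ : 0 < c₃) (hN₁ : 0 ≤ N₁)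
    (hM₁ : 0 ≤ M₁) (hM₂ : 0 ≤ M₂) (hM₃ : 0 ≤ M₃) :
    ∃ c N M : ℝ, 0 < c ∧ 0 ≤ N ∧ 0 ≤ M ∧ ∀ T x : ℝ, 0 ≤ T → 0 < x →
      Real.exp (-(c₁ * T)) * (1 + T) ^ N₁ * (1 + x ^ (-M₁)) ≤ 2 * (Real.exp (-(c * T)) * (1 + T) ^ N * (1 + x ^ (-M))) ∧
      Real.exp (-(c₂ * T)) * (1 + T) ^ N₂ * (1 + x ^ (-M₂)) ≤ 2 * (Real.exp (-(c * T)) * (1 + T) ^ N * (1 + x ^ (-M))) ∧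
      Real.exp (-(c₃ * T)) * (1 + T) ^ N₃ * (1 + x ^ (-M₃)) ≤ 2 * (Real.exp (-(c * T)) * (1 + T) ^ N * (1 + x ^ (-M))) := by
  refine ⟨min (min c₁ c₂) c₃, max (max N₁ N₂) N₃, max (max M₁ M₂) M₃, lt_min (lt_min hc₁ hc₂) hc₃,
    hN₁.trans ((le_max_left _ _).trans (le_max_left _ _)), hM₁.trans ((le_max_left _ _).trans (le_max_left _ _)),
    fun T x hT hx => ⟨?_, ?_, ?_⟩⟩
  · exact face_le_two_mul hT hx ((min_le_left _ _).trans (min_le_left _ _)) ((le_max_left _ _).trans (le_max_left _ _)) hM₁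
      ((le_max_left _ _).trans (le_max_left _ _))
  · exact face_le_two_mul hT hx ((min_le_left _ _).trans (min_le_right _ _)) ((le_max_right _ _).trans (le_max_left _ _)) hM₂
      ((le_max_right _ _).trans (le_max_left _ _))
  · exact face_le_two_mul hT hx (min_le_right _ _) (le_max_right _ _) hM₃ (le_max_right _ _)

/-- **THE STEP ON THE FACE**: `(1+T)·x⁻¹·e^{−cT}(1+T)^N(1 + x^{−M}) ≤ 2·e^{−cT}(1+T)^{N+1}(1 + x^{−(M+1)})` (`T ≥ 0`, `x > 0`, `M ≥ 0`) — one `(det h)⁻¹` and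
one `(1 + Σ‖h‖)` of ★ (J2)'s coefficients absorbed into the exponents. [folklore] -/
theorem face_step {c N M T x : ℝ} (hT : 0 ≤ T) (hx : 0 < x) (hM : 0 ≤ M) :
    (1 + T) * (x⁻¹ * (Real.exp (-(c * T)) * (1 + T) ^ N * (1 + x ^ (-M)))) ≤
      2 * (Real.exp (-(c * T)) * (1 + T) ^ (N + 1) * (1 + x ^ (-(M + 1)))) := by
  have h1 := inv_mul_one_add_rpow_neg_le hx hM
  rw [Real.rpow_add_one (by positivity : (1 + T) ≠ 0)]
  calc (1 + T) * (x⁻¹ * (Real.exp (-(c * T)) * (1 + T) ^ N * (1 + x ^ (-M))))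
      = Real.exp (-(c * T)) * ((1 + T) ^ N * (1 + T)) * (x⁻¹ * (1 + x ^ (-M))) := by ring
    _ ≤ Real.exp (-(c * T)) * ((1 + T) ^ N * (1 + T)) * (2 * (1 + x ^ (-(M + 1)))) :=
        mul_le_mul_of_nonneg_left h1 (mul_nonneg (Real.exp_pos _).le (mul_nonneg (Real.rpow_nonneg (by linarith) N) (by linarith)))
    _ = 2 * (Real.exp (-(c * T)) * ((1 + T) ^ N * (1 + T)) * (1 + x ^ (-(M + 1)))) := by ring

/-- `‖(−4π²·det h)⁻¹‖ ≤ ‖det h‖⁻¹` (`4π² ≥ 1`). [folklore] -/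
theorem norm_inv_neg_four_pi_sq_mul_le (d : ℂ) : ‖(-(4 * (Real.pi : ℂ) ^ 2) * d)⁻¹‖ ≤ ‖d‖⁻¹ := by
  rcases eq_or_ne d 0 with rfl | hd
  · simp
  have hπ : (1 : ℝ) ≤ ‖(-(4 * (Real.pi : ℂ) ^ 2))‖ := by
    rw [norm_neg, norm_mul, norm_pow, Complex.norm_real, Real.norm_eq_abs, abs_of_pos Real.pi_pos, Complex.norm_ofNat]
    nlinarith [Real.pi_gt_three]
  rw [norm_inv, norm_mul]
  exact inv_anti₀ (norm_pos_iff.2 hd) (le_mul_of_one_le_left (norm_nonneg _) hπ)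

/-- In the ball `dist s z < r` with `r ≤ 1`: `‖w + s‖ ≤ ‖w‖ + ‖z‖ + 1`. [folklore] -/
theorem norm_add_le_of_dist_lt {s z : ℂ} {r : ℝ} (hs : dist s z < r) (hr : r ≤ 1) (w : ℂ) : ‖w + s‖ ≤ ‖w‖ + ‖z‖ + 1 := by
  have h1 : ‖s‖ ≤ ‖z‖ + 1 := by
    calc ‖s‖ = ‖z + (s - z)‖ := by congr 1; ring
      _ ≤ ‖z‖ + ‖s - z‖ := norm_add_le _ _
      _ ≤ ‖z‖ + 1 := by rw [← dist_eq_norm]; linarith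
  linarith [norm_add_le w s]

/-- Bookkeeping: `u ≤ C·f₁·f₂·f₃` and `f₁·f₂·f₃ ≤ 2Φ` (`C ≥ 0`) give `u ≤ C·(2Φ)`. [folklore] -/
theorem le_of_face {u C f₁ f₂ f₃ Φ : ℝ} (h1 : u ≤ C * f₁ * f₂ * f₃) (h2 : f₁ * f₂ * f₃ ≤ 2 * Φ) (hC : 0 ≤ C) : u ≤ C * (2 * Φ) :=
  h1.trans (by rw [mul_assoc, mul_assoc]; exact mul_le_mul_of_nonneg_left (by rw [← mul_assoc]; exact h2) hC)

open MeasureTheory Set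
open Summit.HodgeConjecture.HodgeConjecture.Cruxes.HLiu418.K2LiuHermTwoGammaDefs
open Summit.HodgeConjecture.HodgeConjecture.Cruxes.HLiu418.K2LiuHermTwoConfluentXiDefs
open Summit.HodgeConjecture.HodgeConjecture.Cruxes.HLiu418.K2LiuXiTwoMomentsAsHDerivatives (iteratedDeriv_xiTwo_hLine)
open Summit.HodgeConjecture.HodgeConjecture.Cruxes.HLiu418.K2LiuHermTwoXiMomentHolomorphy (differentiableOn_traceMoment)
open Summit.HodgeConjecture.HodgeConjecture.Cruxes.HLiu418.K2LiuHermTwoXiMomentRecursion (traceMoment_eq_of_det_ne_zero)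

/-- **★ (J3)'s CONTINUATION OF THE TRACE MOMENTS, AS A FAMILY IN `h`, WITH GROWTH** (organ «Φ6b-ind» (R3)-G5): given the (G4) decay letter BY VALUE (`‖M_e(h; a+s, b+s)‖ ≤
C·e^{−c·Σ‖h‖}` locally uniformly in `s` on the half-plane of convergence, uniformly in hermitian `h` with `re det h < 0`), for every `N e a b` there is a FAMILY `F h` HOLOMORPHIC on
`{s | 3 + e − N < re(a + b + 2s)}`, equal to `M_e(h; a+s, b+s)` on `{3 + e < re(a+b+2s)}`, with `‖F h s‖ ≤ C·e^{−cΣ‖h‖}·(1 + Σ‖h‖)^{N₊}·(1 + ‖det h‖^{−N′})` near every point of the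
domain, constants uniform in `h` (★ (J3)'s induction verbatim; the step's coefficients `(−4π² det h)⁻¹·(poly in s)`, `(det h)⁻¹·e·tr(adj h Θ)`, `(det h)⁻¹·e(e−1)·det Θ` absorbed by
§1's devices). [cite: Shimura1982, §3 Thm. 3.1, §4 Thm. 4.2] -/
theorem exists_continuation_traceMoment_growth (Θ : Matrix (Fin 2) (Fin 2) ℂ) (hΘ : Θ.IsHermitian)
    (hG4 : ∀ (e : ℕ) (a b z : ℂ), 3 + (e : ℝ) < (a + b + 2 * z).re → ∃ C c r : ℝ, 0 ≤ C ∧ 0 < c ∧ 0 < r ∧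
      ∀ h : Matrix (Fin 2) (Fin 2) ℂ, h.IsHermitian → h.det.re < 0 → ∀ s : ℂ, dist s z < r →
        ‖∫ x : ℝ × ℂ × ℝ, (-(2 * Real.pi * I) * (Θ * hermTwo x).trace) ^ e * xiTwoIntegrand 1 h (a + s) (b + s) x‖ ≤
          C * Real.exp (-(c * ∑ i, ∑ j, ‖h i j‖)))
    (N : ℕ) :
    ∀ (e : ℕ) (a b : ℂ), ∃ F : Matrix (Fin 2) (Fin 2) ℂ → ℂ → ℂ,
      (∀ h : Matrix (Fin 2) (Fin 2) ℂ, h.IsHermitian → h.det.re < 0 →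
        DifferentiableOn ℂ (F h) {s : ℂ | 3 + (e : ℝ) - N < (a + b + 2 * s).re}) ∧
      (∀ h : Matrix (Fin 2) (Fin 2) ℂ, h.IsHermitian → h.det.re < 0 → ∀ s : ℂ, 3 + (e : ℝ) < (a + b + 2 * s).re →
        F h s = ∫ x : ℝ × ℂ × ℝ, (-(2 * Real.pi * I) * (Θ * hermTwo x).trace) ^ e * xiTwoIntegrand 1 h (a + s) (b + s) x) ∧
      ∀ z : ℂ, 3 + (e : ℝ) - N < (a + b + 2 * z).re → ∃ C c Np N' r : ℝ, 0 ≤ C ∧ 0 < c ∧ 0 ≤ Np ∧ 0 ≤ N' ∧ 0 < r ∧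
        ∀ h : Matrix (Fin 2) (Fin 2) ℂ, h.IsHermitian → h.det.re < 0 → ∀ s : ℂ, dist s z < r →
          ‖F h s‖ ≤ C * Real.exp (-(c * ∑ i, ∑ j, ‖h i j‖)) * (1 + ∑ i, ∑ j, ‖h i j‖) ^ Np * (1 + ‖h.det‖ ^ (-N')) := by
  have hT0 : ∀ h : Matrix (Fin 2) (Fin 2) ℂ, 0 ≤ ∑ i, ∑ j, ‖h i j‖ := fun h =>
    Finset.sum_nonneg fun _ _ => Finset.sum_nonneg fun _ _ => norm_nonneg _
  have hdet0 : ∀ h : Matrix (Fin 2) (Fin 2) ℂ, h.det.re < 0 → h.det ≠ 0 := fun h hind h0 => by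
    rw [h0, Complex.zero_re] at hind; exact lt_irrefl _ hind
  induction N with
  | zero =>
    intro e a b
    refine ⟨fun h s => ∫ x : ℝ × ℂ × ℝ, (-(2 * Real.pi * I) * (Θ * hermTwo x).trace) ^ e * xiTwoIntegrand 1 h (a + s) (b + s) x,
      fun h hh _ => ?_, fun h _ _ s _ => rfl, fun z hz => ?_⟩
    · simp only [Nat.cast_zero, sub_zero]
      exact differentiableOn_traceMoment hh Θ e a b
    · simp only [Nat.cast_zero, sub_zero] at hz
      obtain ⟨C, c, r, hC, hc, hr, hB⟩ := hG4 e a b z hz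
      refine ⟨C, c, 0, 0, r, hC, hc, le_rfl, le_rfl, hr, fun h hh hind s hs => ?_⟩
      simp only [Real.rpow_zero, neg_zero, mul_one]
      linarith [hB h hh hind s hs, mul_nonneg hC (Real.exp_pos (-(c * ∑ i, ∑ j, ‖h i j‖))).le]
  | succ N ih =>
    intro e a b
    obtain ⟨F₁, hF₁d, hF₁, hF₁g⟩ := ih e (a + 1) b
    obtain ⟨F₂, hF₂d, hF₂, hF₂g⟩ := ih e a (b + 1)
    obtain ⟨F₃, hF₃d, hF₃, hF₃g⟩ := ih e (a + 1) (b + 1)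
    have hsub1 : {s : ℂ | 3 + (e : ℝ) - ((N + 1 : ℕ) : ℝ) < (a + b + 2 * s).re} ⊆ {s : ℂ | 3 + (e : ℝ) - (N : ℝ) < (a + 1 + b + 2 * s).re} := fun s hs => by simp only [mem_setOf_eq, add_re, one_re, Nat.cast_add, Nat.cast_one] at hs ⊢; linarith
    have hsub2 : {s : ℂ | 3 + (e : ℝ) - ((N + 1 : ℕ) : ℝ) < (a + b + 2 * s).re} ⊆ {s : ℂ | 3 + (e : ℝ) - (N : ℝ) < (a + (b + 1) + 2 * s).re} := fun s hs => by simp only [mem_setOf_eq, add_re, one_re, Nat.cast_add, Nat.cast_one] at hs ⊢; linarith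
    have hsub3 : {s : ℂ | 3 + (e : ℝ) - ((N + 1 : ℕ) : ℝ) < (a + b + 2 * s).re} ⊆ {s : ℂ | 3 + (e : ℝ) - (N : ℝ) < (a + 1 + (b + 1) + 2 * s).re} := fun s hs => by simp only [mem_setOf_eq, add_re, one_re, Nat.cast_add, Nat.cast_one] at hs ⊢; linarith
    have hla : Differentiable ℂ (fun s : ℂ => a + s) := differentiable_id.const_add a
    have hlb : Differentiable ℂ (fun s : ℂ => b + s) := differentiable_id.const_add b
    have hl1 : Differentiable ℂ (fun s : ℂ => a + s + (b + s) - 1) := (hla.add hlb).sub_const 1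
    have hq : Differentiable ℂ (fun s : ℂ => 4 * (a + s) * (b + s)) := ((differentiable_const _).mul hla).mul hlb
    obtain ⟨Fm, hFm⟩ : ∃ Fm : Matrix (Fin 2) (Fin 2) ℂ → ℂ → ℂ, ∀ h s, Fm h s = (-(4 * (Real.pi : ℂ) ^ 2) * h.det)⁻¹ *
        ((a + s + (b + s) - 1) * ((a + s) * F₁ h s + (b + s) * F₂ h s) + 4 * (a + s) * (b + s) * F₃ h s) := ⟨_, fun _ _ => rfl⟩
    have hFm' : ∀ h, Fm h = fun s => (-(4 * (Real.pi : ℂ) ^ 2) * h.det)⁻¹ *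
        ((a + s + (b + s) - 1) * ((a + s) * F₁ h s + (b + s) * F₂ h s) + 4 * (a + s) * (b + s) * F₃ h s) := fun h => funext (hFm h)
    have hmain : ∀ h : Matrix (Fin 2) (Fin 2) ℂ, h.IsHermitian → h.det.re < 0 →
        DifferentiableOn ℂ (Fm h) {s : ℂ | 3 + (e : ℝ) - ((N + 1 : ℕ) : ℝ) < (a + b + 2 * s).re} := fun h hh hind => by
      rw [hFm' h]
      exact (differentiableOn_const _).mul (((hl1.differentiableOn).mul (((hla.differentiableOn).mul ((hF₁d h hh hind).mono hsub1)).add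
        ((hlb.differentiableOn).mul ((hF₂d h hh hind).mono hsub2)))).add ((hq.differentiableOn).mul ((hF₃d h hh hind).mono hsub3)))
    have hmainG : ∀ z : ℂ, 3 + (e : ℝ) - ((N + 1 : ℕ) : ℝ) < (a + b + 2 * z).re → ∃ C c Np N' r : ℝ, 0 ≤ C ∧ 0 < c ∧ 0 ≤ Np ∧ 0 ≤ N' ∧ 0 < r ∧
        ∀ h : Matrix (Fin 2) (Fin 2) ℂ, h.IsHermitian → h.det.re < 0 → ∀ s : ℂ, dist s z < r →
          ‖Fm h s‖ ≤ C * Real.exp (-(c * ∑ i, ∑ j, ‖h i j‖)) * (1 + ∑ i, ∑ j, ‖h i j‖) ^ Np * (1 + ‖h.det‖ ^ (-N')) := by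
      intro z hz
      obtain ⟨C₁, c₁, Np₁, M₁, r₁, hC₁, hc₁, hNp₁, hM₁, hr₁, hB₁⟩ := hF₁g z (hsub1 hz)
      obtain ⟨C₂, c₂, Np₂, M₂, r₂, hC₂, hc₂, -, hM₂, hr₂, hB₂⟩ := hF₂g z (hsub2 hz)
      obtain ⟨C₃, c₃, Np₃, M₃, r₃, hC₃, hc₃, -, hM₃, hr₃, hB₃⟩ := hF₃g z (hsub3 hz)
      obtain ⟨c, Np, M, hc, hNp, hM, hface⟩ := exists_common_face₃ hc₁ hc₂ hc₃ hNp₁ hM₁ hM₂ hM₃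
      refine ⟨4 * ((‖a‖ + ‖z‖ + 1 + (‖b‖ + ‖z‖ + 1) + 1) * ((‖a‖ + ‖z‖ + 1) * C₁ + (‖b‖ + ‖z‖ + 1) * C₂) +
          4 * (‖a‖ + ‖z‖ + 1) * (‖b‖ + ‖z‖ + 1) * C₃), c, Np + 1, M + 1, min (min r₁ r₂) (min r₃ 1),
        by positivity, hc, by linarith, by linarith, lt_min (lt_min hr₁ hr₂) (lt_min hr₃ one_pos), fun h hh hind s hs => ?_⟩
      have hx : 0 < ‖h.det‖ := norm_pos_iff.2 (hdet0 h hind)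
      simp only [lt_min_iff] at hs; obtain ⟨⟨hs₁, hs₂⟩, hs₃, hs1⟩ := hs
      have hα : ‖a + s‖ ≤ ‖a‖ + ‖z‖ + 1 := norm_add_le_of_dist_lt hs1 le_rfl a
      have hβ : ‖b + s‖ ≤ ‖b‖ + ‖z‖ + 1 := norm_add_le_of_dist_lt hs1 le_rfl b
      have hl : ‖a + s + (b + s) - 1‖ ≤ ‖a‖ + ‖z‖ + 1 + (‖b‖ + ‖z‖ + 1) + 1 :=
        (norm_sub_le _ _).trans (by rw [norm_one]; linarith [norm_add_le (a + s) (b + s)])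
      obtain ⟨hf₁, hf₂, hf₃⟩ := hface (∑ i, ∑ j, ‖h i j‖) ‖h.det‖ (hT0 h) hx
      set T : ℝ := ∑ i, ∑ j, ‖h i j‖ with hT
      set Φ : ℝ := Real.exp (-(c * T)) * (1 + T) ^ Np * (1 + ‖h.det‖ ^ (-M)) with hΦ
      have hTnn : 0 ≤ T := hT0 h
      have hΦ0 : 0 ≤ Φ := by positivity
      have hb₁ : ‖F₁ h s‖ ≤ C₁ * (2 * Φ) := le_of_face (hB₁ h hh hind s hs₁) hf₁ hC₁
      have hb₂ : ‖F₂ h s‖ ≤ C₂ * (2 * Φ) := le_of_face (hB₂ h hh hind s hs₂) hf₂ hC₂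
      have hb₃ : ‖F₃ h s‖ ≤ C₃ * (2 * Φ) := le_of_face (hB₃ h hh hind s hs₃) hf₃ hC₃
      have hn1 : ‖(a + s + (b + s) - 1) * ((a + s) * F₁ h s + (b + s) * F₂ h s)‖ ≤
          (‖a‖ + ‖z‖ + 1 + (‖b‖ + ‖z‖ + 1) + 1) * ((‖a‖ + ‖z‖ + 1) * (C₁ * (2 * Φ)) + (‖b‖ + ‖z‖ + 1) * (C₂ * (2 * Φ))) := by
        rw [norm_mul]
        refine mul_le_mul hl ((norm_add_le _ _).trans (add_le_add ?_ ?_)) (norm_nonneg _) (by positivity)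
        · rw [norm_mul]; exact mul_le_mul hα hb₁ (norm_nonneg _) (by positivity)
        · rw [norm_mul]; exact mul_le_mul hβ hb₂ (norm_nonneg _) (by positivity)
      have hn2 : ‖4 * (a + s) * (b + s) * F₃ h s‖ ≤ 4 * (‖a‖ + ‖z‖ + 1) * (‖b‖ + ‖z‖ + 1) * (C₃ * (2 * Φ)) := by
        rw [norm_mul, norm_mul, norm_mul, Complex.norm_ofNat]
        exact mul_le_mul (mul_le_mul (mul_le_mul_of_nonneg_left hα (by norm_num)) hβ (norm_nonneg _) (by positivity)) hb₃ (norm_nonneg _) (by positivity)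
      have hstep := face_step (c := c) (N := Np) hTnn hx hM
      set K : ℝ := (‖a‖ + ‖z‖ + 1 + (‖b‖ + ‖z‖ + 1) + 1) * ((‖a‖ + ‖z‖ + 1) * C₁ + (‖b‖ + ‖z‖ + 1) * C₂) +
        4 * (‖a‖ + ‖z‖ + 1) * (‖b‖ + ‖z‖ + 1) * C₃ with hK
      have hK0 : 0 ≤ K := by rw [hK]; positivity
      calc ‖Fm h s‖ = ‖(-(4 * (Real.pi : ℂ) ^ 2) * h.det)⁻¹‖ *
            ‖(a + s + (b + s) - 1) * ((a + s) * F₁ h s + (b + s) * F₂ h s) + 4 * (a + s) * (b + s) * F₃ h s‖ := by rw [hFm, norm_mul]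
        _ ≤ ‖h.det‖⁻¹ * ((‖a‖ + ‖z‖ + 1 + (‖b‖ + ‖z‖ + 1) + 1) * ((‖a‖ + ‖z‖ + 1) * (C₁ * (2 * Φ)) + (‖b‖ + ‖z‖ + 1) * (C₂ * (2 * Φ))) +
              4 * (‖a‖ + ‖z‖ + 1) * (‖b‖ + ‖z‖ + 1) * (C₃ * (2 * Φ))) :=
            mul_le_mul (norm_inv_neg_four_pi_sq_mul_le _) ((norm_add_le _ _).trans (add_le_add hn1 hn2)) (norm_nonneg _) (by positivity)
        _ = 2 * K * (‖h.det‖⁻¹ * Φ) := by rw [hK]; ring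
        _ ≤ 2 * K * ((1 + T) * (‖h.det‖⁻¹ * Φ)) := mul_le_mul_of_nonneg_left (le_mul_of_one_le_left (by positivity) (by linarith)) (by positivity)
        _ ≤ 2 * K * (2 * (Real.exp (-(c * T)) * (1 + T) ^ (Np + 1) * (1 + ‖h.det‖ ^ (-(M + 1))))) :=
            mul_le_mul_of_nonneg_left (by rw [hΦ]; exact hstep) (by positivity)
        _ = _ := by ring
    have hconv : ∀ s : ℂ, 3 + (e : ℝ) < (a + b + 2 * s).re →
        3 + (e : ℝ) < (a + 1 + b + 2 * s).re ∧ 3 + (e : ℝ) < (a + (b + 1) + 2 * s).re ∧ 3 + (e : ℝ) < (a + 1 + (b + 1) + 2 * s).re ∧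
          3 + (e : ℝ) < (a + s + (b + s)).re := fun s hs => by
      simp only [add_re, one_re, mul_re, re_ofNat, im_ofNat, zero_mul, sub_zero] at hs ⊢
      refine ⟨by linarith, by linarith, by linarith, by linarith⟩
    have e1 : ∀ s : ℂ, a + 1 + s = a + s + 1 := fun s => by ring
    have e2 : ∀ s : ℂ, b + 1 + s = b + s + 1 := fun s => by ring
    rcases e with _ | e
    · -- order 0: no lower moments
      refine ⟨Fm, hmain, fun h hh hind s hs => ?_, hmainG⟩
      obtain ⟨hs1, hs2, hs3, hαβ⟩ := hconv s hs
      rw [hFm, hF₁ h hh hind s hs1, hF₂ h hh hind s hs2, hF₃ h hh hind s hs3, e1, e2,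
        traceMoment_eq_of_det_ne_zero hΘ 0 hh (hdet0 h hind) hαβ]
      simp only [Nat.cast_zero, zero_mul, add_zero, mul_zero, sub_zero]
    · -- order `e + 1`: the lower moments of orders `e` and `e - 1`, continued with growth by the induction hypothesis at the same base point
      obtain ⟨G₁, hG₁d, hG₁, hG₁g⟩ := ih e a b
      obtain ⟨G₂, hG₂d, hG₂, hG₂g⟩ := ih (e - 1) a b
      have hc2 : ((e - 1 : ℕ) : ℝ) ≤ (e : ℝ) := by exact_mod_cast Nat.sub_le e 1
      have hsubG1 : {s : ℂ | 3 + ((e + 1 : ℕ) : ℝ) - ((N + 1 : ℕ) : ℝ) < (a + b + 2 * s).re} ⊆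
          {s : ℂ | 3 + (e : ℝ) - (N : ℝ) < (a + b + 2 * s).re} := fun s hs => by simp only [mem_setOf_eq, Nat.cast_add, Nat.cast_one] at hs ⊢; linarith
      have hsubG2 : {s : ℂ | 3 + ((e + 1 : ℕ) : ℝ) - ((N + 1 : ℕ) : ℝ) < (a + b + 2 * s).re} ⊆
          {s : ℂ | 3 + ((e - 1 : ℕ) : ℝ) - (N : ℝ) < (a + b + 2 * s).re} := fun s hs => by simp only [mem_setOf_eq, Nat.cast_add, Nat.cast_one] at hs ⊢; linarith
      obtain ⟨Fl, hFl⟩ : ∃ Fl : Matrix (Fin 2) (Fin 2) ℂ → ℂ → ℂ, ∀ h s, Fl h s = (h.det)⁻¹ * (((e + 1 : ℕ) : ℂ) * (h.adjugate * Θ).trace * G₁ h s +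
          ((e + 1 : ℕ) : ℂ) * (((e + 1 : ℕ) : ℂ) - 1) * Θ.det * G₂ h s) := ⟨_, fun _ _ => rfl⟩
      have hFl' : ∀ h, Fl h = fun s => (h.det)⁻¹ * (((e + 1 : ℕ) : ℂ) * (h.adjugate * Θ).trace * G₁ h s +
          ((e + 1 : ℕ) : ℂ) * (((e + 1 : ℕ) : ℂ) - 1) * Θ.det * G₂ h s) := fun h => funext (hFl h)
      have hlow : ∀ h : Matrix (Fin 2) (Fin 2) ℂ, h.IsHermitian → h.det.re < 0 →
          DifferentiableOn ℂ (Fl h) {s : ℂ | 3 + ((e + 1 : ℕ) : ℝ) - ((N + 1 : ℕ) : ℝ) < (a + b + 2 * s).re} := fun h hh hind => by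
        rw [hFl' h]
        exact (differentiableOn_const _).mul (((differentiableOn_const _).mul ((hG₁d h hh hind).mono hsubG1)).add
          ((differentiableOn_const _).mul ((hG₂d h hh hind).mono hsubG2)))
      have hE1 : ‖((e + 1 : ℕ) : ℂ)‖ ≤ (e : ℝ) + 2 := by rw [Complex.norm_natCast]; push_cast; linarith
      have hE2 : ‖((e + 1 : ℕ) : ℂ) - 1‖ ≤ (e : ℝ) + 2 := by
        rw [show ((e + 1 : ℕ) : ℂ) - 1 = (e : ℂ) by push_cast; ring, Complex.norm_natCast]; linarith
      have hlowG : ∀ z : ℂ, 3 + ((e + 1 : ℕ) : ℝ) - ((N + 1 : ℕ) : ℝ) < (a + b + 2 * z).re → ∃ C c Np N' r : ℝ, 0 ≤ C ∧ 0 < c ∧ 0 ≤ Np ∧ 0 ≤ N' ∧ 0 < r ∧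
          ∀ h : Matrix (Fin 2) (Fin 2) ℂ, h.IsHermitian → h.det.re < 0 → ∀ s : ℂ, dist s z < r →
            ‖Fl h s‖ ≤ C * Real.exp (-(c * ∑ i, ∑ j, ‖h i j‖)) * (1 + ∑ i, ∑ j, ‖h i j‖) ^ Np * (1 + ‖h.det‖ ^ (-N')) := by
        intro z hz
        obtain ⟨C₁, c₁, Np₁, M₁, r₁, hC₁, hc₁, hNp₁, hM₁, hr₁, hB₁⟩ := hG₁g z (hsubG1 hz)
        obtain ⟨C₂, c₂, Np₂, M₂, r₂, hC₂, hc₂, -, hM₂, hr₂, hB₂⟩ := hG₂g z (hsubG2 hz)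
        obtain ⟨c, Np, M, hc, hNp, hM, hface⟩ := exists_common_face₃ (N₃ := Np₂) hc₁ hc₂ hc₂ hNp₁ hM₁ hM₂ hM₂
        refine ⟨4 * (((e : ℝ) + 2) * (∑ i, ∑ j, ‖Θ i j‖) * C₁ + ((e : ℝ) + 2) * ((e : ℝ) + 2) * ‖Θ.det‖ * C₂), c, Np + 1, M + 1, min r₁ r₂,
          by positivity, hc, by linarith, by linarith, lt_min hr₁ hr₂, fun h hh hind s hs => ?_⟩
        have hx : 0 < ‖h.det‖ := norm_pos_iff.2 (hdet0 h hind)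
        simp only [lt_min_iff] at hs; obtain ⟨hs₁, hs₂⟩ := hs
        have hadj := norm_trace_adjugate_mul_le h Θ
        obtain ⟨hf₁, hf₂, -⟩ := hface (∑ i, ∑ j, ‖h i j‖) ‖h.det‖ (hT0 h) hx
        set T : ℝ := ∑ i, ∑ j, ‖h i j‖ with hT
        set Φ : ℝ := Real.exp (-(c * T)) * (1 + T) ^ Np * (1 + ‖h.det‖ ^ (-M)) with hΦ
        have hTnn : 0 ≤ T := hT0 h
        have hΘ0 : 0 ≤ ∑ i, ∑ j, ‖Θ i j‖ := hT0 Θ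
        have hΦ0 : 0 ≤ Φ := by positivity
        have hb₁ : ‖G₁ h s‖ ≤ C₁ * (2 * Φ) := le_of_face (hB₁ h hh hind s hs₁) hf₁ hC₁
        have hb₂ : ‖G₂ h s‖ ≤ C₂ * (2 * Φ) := le_of_face (hB₂ h hh hind s hs₂) hf₂ hC₂
        have hn3 : ‖((e + 1 : ℕ) : ℂ) * (h.adjugate * Θ).trace * G₁ h s‖ ≤ ((e : ℝ) + 2) * ((∑ i, ∑ j, ‖Θ i j‖) * (1 + T)) * (C₁ * (2 * Φ)) := by
          rw [norm_mul, norm_mul]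
          exact mul_le_mul (mul_le_mul hE1 hadj (norm_nonneg _) (by positivity)) hb₁ (norm_nonneg _) (by positivity)
        have hn4 : ‖((e + 1 : ℕ) : ℂ) * (((e + 1 : ℕ) : ℂ) - 1) * Θ.det * G₂ h s‖ ≤ ((e : ℝ) + 2) * ((e : ℝ) + 2) * ‖Θ.det‖ * (C₂ * (2 * Φ)) * (1 + T) := by
          rw [norm_mul, norm_mul, norm_mul]
          exact (mul_le_mul (mul_le_mul_of_nonneg_right (mul_le_mul hE1 hE2 (norm_nonneg _) (by positivity)) (norm_nonneg _)) hb₂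
            (norm_nonneg _) (by positivity)).trans (le_mul_of_one_le_right (by positivity) (by linarith))
        have hstep := face_step (c := c) (N := Np) hTnn hx hM
        set K : ℝ := ((e : ℝ) + 2) * (∑ i, ∑ j, ‖Θ i j‖) * C₁ + ((e : ℝ) + 2) * ((e : ℝ) + 2) * ‖Θ.det‖ * C₂ with hK
        have hK0 : 0 ≤ K := by rw [hK]; positivity
        calc ‖Fl h s‖ = ‖(h.det)⁻¹‖ * ‖((e + 1 : ℕ) : ℂ) * (h.adjugate * Θ).trace * G₁ h s +
              ((e + 1 : ℕ) : ℂ) * (((e + 1 : ℕ) : ℂ) - 1) * Θ.det * G₂ h s‖ := by rw [hFl, norm_mul]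
          _ ≤ ‖h.det‖⁻¹ * (((e : ℝ) + 2) * ((∑ i, ∑ j, ‖Θ i j‖) * (1 + T)) * (C₁ * (2 * Φ)) +
                ((e : ℝ) + 2) * ((e : ℝ) + 2) * ‖Θ.det‖ * (C₂ * (2 * Φ)) * (1 + T)) := by
              rw [norm_inv]; exact mul_le_mul_of_nonneg_left ((norm_add_le _ _).trans (add_le_add hn3 hn4)) (by positivity)
          _ = 2 * K * ((1 + T) * (‖h.det‖⁻¹ * Φ)) := by rw [hK]; ring
          _ ≤ 2 * K * (2 * (Real.exp (-(c * T)) * (1 + T) ^ (Np + 1) * (1 + ‖h.det‖ ^ (-(M + 1))))) := mul_le_mul_of_nonneg_left (by rw [hΦ]; exact hstep) (by positivity)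
          _ = _ := by ring
      refine ⟨fun h s => Fm h s - Fl h s, fun h hh hind => (hmain h hh hind).sub (hlow h hh hind), fun h hh hind s hs => ?_, fun z hz => ?_⟩
      · -- the formula on the half-plane of convergence (★ (J2))
        obtain ⟨hs1, hs2, hs3, hαβ⟩ := hconv s hs
        have hsG1 : 3 + (e : ℝ) < (a + b + 2 * s).re := by push_cast at hs; linarith
        have hsG2 : 3 + ((e - 1 : ℕ) : ℝ) < (a + b + 2 * s).re := by linarith
        have hrec := traceMoment_eq_of_det_ne_zero hΘ (e + 1) hh (hdet0 h hind) hαβ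
        have i1 : e + 1 - 1 = e := by omega
        have i2 : e + 1 - 2 = e - 1 := by omega
        rw [i1, i2] at hrec
        simp only
        rw [hFm, hFl, hF₁ h hh hind s hs1, hF₂ h hh hind s hs2, hF₃ h hh hind s hs3, hG₁ h hh hind s hsG1, hG₂ h hh hind s hsG2, e1, e2]
        exact hrec.symm
      · -- GROWTH of the difference: the two packs merged
        obtain ⟨C₁, c₁, Np₁, M₁, r₁, hC₁, hc₁, hNp₁, hM₁, hr₁, hB₁⟩ := hmainG z hz
        obtain ⟨C₂, c₂, Np₂, M₂, r₂, hC₂, hc₂, -, hM₂, hr₂, hB₂⟩ := hlowG z hz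
        obtain ⟨c, Np, M, hc, hNp, hM, hface⟩ := exists_common_face₃ (N₃ := Np₂) hc₁ hc₂ hc₂ hNp₁ hM₁ hM₂ hM₂
        refine ⟨2 * (C₁ + C₂), c, Np, M, min r₁ r₂, by positivity, hc, hNp, hM, lt_min hr₁ hr₂, fun h hh hind s hs => ?_⟩
        have hx : 0 < ‖h.det‖ := norm_pos_iff.2 (hdet0 h hind)
        obtain ⟨hf₁, hf₂, -⟩ := hface (∑ i, ∑ j, ‖h i j‖) ‖h.det‖ (hT0 h) hx
        set T : ℝ := ∑ i, ∑ j, ‖h i j‖ with hT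
        set Φ : ℝ := Real.exp (-(c * T)) * (1 + T) ^ Np * (1 + ‖h.det‖ ^ (-M)) with hΦ
        have hb₁ : ‖Fm h s‖ ≤ C₁ * (2 * Φ) := le_of_face (hB₁ h hh hind s (lt_of_lt_of_le hs (min_le_left _ _))) hf₁ hC₁
        have hb₂ : ‖Fl h s‖ ≤ C₂ * (2 * Φ) := le_of_face (hB₂ h hh hind s (lt_of_lt_of_le hs (min_le_right _ _))) hf₂ hC₂
        simp only
        calc ‖Fm h s - Fl h s‖ ≤ ‖Fm h s‖ + ‖Fl h s‖ := norm_sub_le _ _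
          _ ≤ C₁ * (2 * Φ) + C₂ * (2 * Φ) := add_le_add hb₁ hb₂
          _ = _ := by rw [hΦ]; ring

/-- **THE JET-CONTINUATION LETTER WITH GROWTH, `hJet_holds_growth`** (organ «Φ6b-ind» (R3)-G5, the head of record; KW desk F0P2-p08 (g4) 2026-09-05T01:31:06Z (B)): given the (G4)
decay letter BY VALUE, for hermitian `Θ` and every `e a b` there are a FAMILY `F h` and the `h`-free abscissa `s₀ = (3 + e − re(a+b))∕2` with: for every `h` with `hᴴ = h`, `re det h < 0`,
`F h` is HOLOMORPHIC on `{0 < re s}` and equals the jet `(d∕dt)^e ξ(1, h + tΘ; a+s, b+s)|₀` on `{s₀ < re s}` (★ `iteratedDeriv_xiTwo_hLine`); and near every `z` with `0 < re z`,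
`‖F h s‖ ≤ C·e^{−cΣ‖h‖}(1 + Σ‖h‖)^{N}(1 + ‖det h‖^{−N′})`, constants depending on `(Θ, e, a, b, z)` only. [cite: Shimura1982, §4 Thm. 4.2] [cite: Shimura1997, §16.5, §18.4] -/
theorem hJet_holds_growth (Θ : Matrix (Fin 2) (Fin 2) ℂ) (hΘ : Θ.IsHermitian)
    (hG4 : ∀ (e : ℕ) (a b z : ℂ), 3 + (e : ℝ) < (a + b + 2 * z).re → ∃ C c r : ℝ, 0 ≤ C ∧ 0 < c ∧ 0 < r ∧
      ∀ h : Matrix (Fin 2) (Fin 2) ℂ, h.IsHermitian → h.det.re < 0 → ∀ s : ℂ, dist s z < r →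
        ‖∫ x : ℝ × ℂ × ℝ, (-(2 * Real.pi * I) * (Θ * hermTwo x).trace) ^ e * xiTwoIntegrand 1 h (a + s) (b + s) x‖ ≤
          C * Real.exp (-(c * ∑ i, ∑ j, ‖h i j‖)))
    (e : ℕ) (a b : ℂ) :
    ∃ (F : Matrix (Fin 2) (Fin 2) ℂ → ℂ → ℂ) (s₀ : ℝ),
      (∀ h : Matrix (Fin 2) (Fin 2) ℂ, hᴴ = h → h.det.re < 0 →
        DifferentiableOn ℂ (F h) {s : ℂ | 0 < s.re} ∧
          ∀ s : ℂ, s₀ < s.re → F h s = iteratedDeriv e (fun t : ℝ => xiTwo 1 (h + (t : ℂ) • Θ) (a + s) (b + s)) 0) ∧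
      ∀ z : ℂ, 0 < z.re → ∃ C c Np N' r : ℝ, 0 ≤ C ∧ 0 < c ∧ 0 ≤ Np ∧ 0 ≤ N' ∧ 0 < r ∧
        ∀ h : Matrix (Fin 2) (Fin 2) ℂ, hᴴ = h → h.det.re < 0 → ∀ s : ℂ, dist s z < r →
          ‖F h s‖ ≤ C * Real.exp (-(c * ∑ i, ∑ j, ‖h i j‖)) * (1 + ∑ i, ∑ j, ‖h i j‖) ^ Np * (1 + ‖h.det‖ ^ (-N')) := by
  obtain ⟨F, hFd, hF, hFg⟩ := exists_continuation_traceMoment_growth Θ hΘ hG4 ⌈3 + (e : ℝ) - (a + b).re⌉₊ e a b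
  have hceil : 3 + (e : ℝ) - (a + b).re ≤ (⌈3 + (e : ℝ) - (a + b).re⌉₊ : ℝ) := Nat.le_ceil _
  have hdom : ∀ s : ℂ, 0 < s.re → 3 + (e : ℝ) - (⌈3 + (e : ℝ) - (a + b).re⌉₊ : ℝ) < (a + b + 2 * s).re := fun s hs => by
    simp only [add_re, two_mul] at hs hceil ⊢
    linarith
  refine ⟨F, (3 + (e : ℝ) - (a + b).re) / 2, fun h hherm hind => ⟨(hFd h hherm hind).mono fun s hs => hdom s hs, fun s hs => ?_⟩,
    fun z hz => ?_⟩
  · have hs' : 3 + (e : ℝ) < (a + b + 2 * s).re := by simp only [add_re, two_mul] at hs ⊢; linarith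
    have hαβ : 3 + (e : ℝ) < (a + s + (b + s)).re := by
      have e0 : (a + s + (b + s)).re = (a + b + 2 * s).re := by congr 1; ring
      rw [e0]; exact hs'
    rw [hF h hherm hind s hs', iteratedDeriv_xiTwo_hLine hherm hΘ e hαβ 0]
    simp only [ofReal_zero, zero_smul, add_zero]
  · obtain ⟨C, c, Np, N', r, hC, hc, hNp, hN', hr, hB⟩ := hFg z (hdom z hz)
    exact ⟨C, c, Np, N', r, hC, hc, hNp, hN', hr, fun h hherm hind s hs => hB h hherm hind s hs⟩

end Summit.HodgeConjecture.HodgeConjecture.Cruxes.HLiu418.K2LiuHermTwoXiJetContinuationGrowth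

end
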